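import Summits.AnomalousDissipation.AnomalousDissipation.Theorems.BaireTransferRobustLoudUpgradeStubPeriodicWindow

/-!
# Stub `stub_periodicRobustCrossingClosure` of the line `malkin-cone-group-orbits`
# (crux stmt-AnomalousDissipation-1144, `BaireTransfer.RobustLoudUpgrade`; companion c3, engine E2)

The ROBUST-CROSSING ENGINE of the periodic Lyapunov–Schmidt companion line (the time-periodic twin
of `RobustCrossingClosure.stub_robustCrossingClosure`).  Data: a `τ`-periodic classical solution `u`
of `NS_ν(f_c)` on `ℝ × T³`, `ν ∈ (0,a)`, with STRICT budgets `⟨‖u‖²⟩ < E`, `ε < ⟨ν‖∇u‖²⟩`, and a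
real function `σ` on `P_S × ℝ` (the reduced function of the line) such that

* for every `δ > 0`, on some ball around `(c, 0)` the function `σ` is continuous and each of its
  zeros `q = (c', s)` yields a `τ'`-periodic classical solution `u'` of `NS_ν(f_{c'})` with
  `∫‖u'(t) − u(τt/τ')‖² + ‖∇(u'(t) − u(τt/τ'))‖₂² ≤ δ` for all `t`;
* `σ (c₁, ·)` changes sign strictly, at points `s₁, s₂` arbitrarily close to `0`, for forces `c₁`
  arbitrarily close to `c`.

Conclusion: `c ∈ closure (interior (loud S a E ε))`.

Proof.  (1) WINDOW (verbatim the budget bookkeeping of `PeriodicWindow.stub_periodicWindow`):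
`PeriodicWindow.exists_eta` picks `η > 0` inside the strict slack, `PeriodicWindow.exists_delta`
then `δ > 0` absorbing a uniform-in-time `L² ∩ Ḣ¹` perturbation of squared size `δ`, and
`PeriodicWindow.meanEnergy_le_of_close` / `PeriodicWindow.meanDissipation_ge_of_close` show that
every `τ'`-periodic classical solution `u'` of ANY force `f_e` at the same `ν` which is `δ`-close to
the time-rescaled `u` has budgets `≤ E`, `≥ ε`, so `e ∈ loud S a E ε`.  (2) The first hypothesis at
this `δ` gives a radius `r`.  (3) CLOSURE: given `θ > 0`, the second hypothesis with
`η := min θ (r/2)` gives `c₁, s₁, s₂`; continuity of `c' ↦ σ (c', sᵢ)` at `c₁` keeps the strict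
signs on a ball `dist c' c₁ < ρ'`; for `dist c' c₁ < min ρ' (r/2)` the segment `{c'} × [s₁, s₂]`
lies in the ball of radius `r` (sup metric), so the intermediate value theorem produces a zero
`(c', s)` of `σ`, hence a `δ`-close periodic solution of `f_{c'}`, hence `c' ∈ loud`.  Thus a ball
around `c₁` is loud, `c₁ ∈ interior loud`, and `dist c c₁ < θ`.

References: D. Henry, *Geometric Theory of Semilinear Parabolic Equations*, LNM 840 (1981), Ch. 8;
the vocabulary module `Theorems/BaireTransferRobustLoudUpgradeLine.lean`; the templates
`Theorems/BaireTransferRobustLoudUpgradeStubRobustCrossingClosure.lean` (steady twin) and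
`Theorems/BaireTransferRobustLoudUpgradeStubPeriodicWindow.lean` (periodic window).
-/

-- `Summit.<Summit>.<Problem>` is the tree's mandated summit-side namespace (CONVENTIONS §2); for this
-- single-conjunct summit the two coincide, so the duplicate is deliberate.
set_option linter.dupNamespace false

noncomputable section

open scoped BigOperators Topology
open Filter Set Function TopologicalSpace MeasureTheory

namespace Summit.AnomalousDissipation.AnomalousDissipation.Theorems.RobustLoudUpgrade.PeriodicRobustCrossingClosure

open Literature.Analysis.FunctionSpaces Literature.Analysis.FunctionSpaces.Torus
open Literature.Analysis.FluidPDE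
open Summit.AnomalousDissipation.AnomalousDissipation.Theses.BaireTransfer
open Summit.AnomalousDissipation.AnomalousDissipation.Theorems.RobustLoudUpgrade

/-! ## The periodic budget window -/

/-- **Budget window of a strict periodic witness** (the bookkeeping of
`PeriodicWindow.stub_periodicWindow`, packaged): if `u` is a `τ`-periodic classical solution of
`NS_ν(f_c)` with `meanEnergy u < E` and `ε < meanDissipation ν u`, `0 < ν < a`, then there is `δ > 0`
such that every `τ'`-periodic classical solution `u'` of `NS_ν(f_e)` (any `e ∈ P_S`) which stays,
uniformly in time, within squared `L² ∩ Ḣ¹` distance `δ` of the time-rescaled `u` makes `e` loud.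
[folklore] -/
theorem exists_window {S : Finset (Fin 3 → ℤ)} {a E ε ν τ : ℝ} {c : Coeff S}
    {u : ℝ → UnitAddTorus (Fin 3) → EuclideanSpace ℝ (Fin 3)} {p : ℝ → UnitAddTorus (Fin 3) → ℝ}
    (hν : 0 < ν) (hνa : ν < a) (hτ : 0 < τ)
    (hsol : IsClassicalNSSolutionOn Set.univ ν (fun _ => force S c) u p)
    (hper : Function.Periodic u τ) (hE : meanEnergy u < E) (hε : ε < meanDissipation ν u) :
    ∃ δ : ℝ, 0 < δ ∧ ∀ (e : Coeff S) (τ' : ℝ)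
      (u' : ℝ → UnitAddTorus (Fin 3) → EuclideanSpace ℝ (Fin 3)) (p' : ℝ → UnitAddTorus (Fin 3) → ℝ),
      0 < τ' → IsClassicalNSSolutionOn Set.univ ν (fun _ => force S e) u' p' →
        Function.Periodic u' τ' →
        (∀ t, (∫ x, ‖u' t x - u (τ / τ' * t) x‖ ^ 2) +
          gradNormSq (fun x => u' t x - u (τ / τ' * t) x) ≤ δ) →
        e ∈ loud S a E ε := by
  -- adapted from Theorems/BaireTransferRobustLoudUpgradeStubPeriodicWindow.lean `stub_periodicWindow`
  have hu := hsol.smooth_velocity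
  obtain ⟨η, hη, hηE, hηD⟩ := PeriodicWindow.exists_eta hE hε
  obtain ⟨δ, hδ, hδE, hδD⟩ := PeriodicWindow.exists_delta (sE := E - (1 + η) * meanEnergy u)
    (sD := meanDissipation ν u - (1 + η) * ε) (by linarith) (by linarith) hν hη
  refine ⟨δ, hδ, fun e τ' u' p' hτ' hsol' hper' hcl => ?_⟩
  have hu' := hsol'.smooth_velocity
  refine ⟨ν, hν, hνa, τ', u', p', hτ', hsol', hper', ?_, ?_⟩
  · -- energy budget `⟨‖u'‖²⟩ ≤ E`
    have hcl2 : ∀ t, ∫ x, ‖u' t x - u (τ / τ' * t) x‖ ^ 2 ≤ δ := fun t =>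
      le_trans (le_add_of_nonneg_right (gradNormSq_nonneg _)) (hcl t)
    have h := PeriodicWindow.meanEnergy_le_of_close hu hper hτ hu' hper' hτ' hη hcl2
    linarith
  · -- dissipation budget `ε ≤ ⟨ν‖∇u'‖²⟩`
    have hcl1 : ∀ t, gradNormSq (fun x => u' t x - u (τ / τ' * t) x) ≤ δ := fun t =>
      le_trans (le_add_of_nonneg_left (integral_nonneg fun x => sq_nonneg _)) (hcl t)
    have h := PeriodicWindow.meanDissipation_ge_of_close hu hper hτ hu' hper' hτ' hν.le hη hcl1
    have hη1 : 0 < 1 + η := by linarith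
    have h2 : ε ≤ (1 + η)⁻¹ * (meanDissipation ν u - ν * ((1 + η⁻¹) * δ)) := by
      rw [le_inv_mul_iff₀ hη1]
      linarith
    exact h2.trans h

/-! ## Sup-metric bookkeeping on `P_S × ℝ` -/

/-- Sup metric on a product: `(c', x)` is `ρ`-close to `(c, 0)` as soon as `dist c' c < ρ` and
`|x| < ρ`. [folklore] -/
private lemma dist_mk_lt {V : Type*} [PseudoMetricSpace V] {c' c : V} {x ρ : ℝ}
    (hc : dist c' c < ρ) (hx : |x| < ρ) : dist (c', x) (c, (0 : ℝ)) < ρ := by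
  -- adapted from Theorems/BaireTransferRobustLoudUpgradeStubRobustCrossingClosure.lean `dist_mk_lt`
  rw [Prod.dist_eq]
  show max (dist c' c) (dist x 0) < ρ
  rw [Real.dist_eq, sub_zero]
  exact max_lt hc hx

/-- A point of the unordered segment `[[x₁, x₂]]` is no larger in absolute value than the larger
endpoint: `|x₁| < b`, `|x₂| < b`, `x ∈ [[x₁, x₂]]` give `|x| < b`. [folklore] -/
private lemma abs_lt_of_mem_uIcc {x₁ x₂ x b : ℝ} (h₁ : |x₁| < b) (h₂ : |x₂| < b)
    (hx : x ∈ Set.uIcc x₁ x₂) : |x| < b := by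
  -- adapted from Theorems/BaireTransferRobustLoudUpgradeStubRobustCrossingClosure.lean
  rw [abs_lt] at h₁ h₂ ⊢
  rcases Set.mem_uIcc.1 hx with ⟨hl, hu⟩ | ⟨hl, hu⟩
  · exact ⟨by linarith [h₁.1], by linarith [h₂.2]⟩
  · exact ⟨by linarith [h₂.1], by linarith [h₁.2]⟩

/-! ## The stub -/

/-- **Robust periodic crossing ⇒ closure of the loud interior** (registered stub
`stub_periodicRobustCrossingClosure` of the line `malkin-cone-group-orbits`, companion c3, engine E2).
At a loud `τ`-periodic classical witness `u` with STRICT budgets, a real family `σ` which is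
continuous near `(c, 0)` with zeros giving uniformly `L² ∩ Ḣ¹`-close periodic classical solutions
(for every closeness `δ`), and which changes sign strictly in `s` near `0` at forces `c₁`
arbitrarily close to `c`, puts `c` in `closure (interior (loud S a E ε))`: the strict sign change
persists for `c'` near `c₁`, the intermediate value theorem gives a zero of `σ (c', ·)`, hence a
periodic solution of `f_{c'}` inside the budget window of `u`, so a ball around `c₁` is loud.
[folklore] -/
theorem stub_periodicRobustCrossingClosure : ∀ (S : Finset (Fin 3 → ℤ)) (a E ε : ℝ) (c : Coeff S) (ν τ : ℝ) (u : ℝ → UnitAddTorus (Fin 3) → EuclideanSpace ℝ (Fin 3)) (p : ℝ → UnitAddTorus (Fin 3) → ℝ) (σ : Coeff S × ℝ → ℝ), 0 < ν → ν < a → 0 < τ → IsClassicalNSSolutionOn Set.univ ν (fun _ => force S c) u p → Function.Periodic u τ → meanEnergy u < E → ε < meanDissipation ν u → (∀ δ : ℝ, 0 < δ → ∃ r : ℝ, 0 < r ∧ ContinuousOn σ (Metric.ball (c, (0 : ℝ)) r) ∧ ∀ q ∈ Metric.ball (c, (0 : ℝ)) r, σ q = 0 → ∃ (τ' : ℝ)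 (u' : ℝ → UnitAddTorus (Fin 3) → EuclideanSpace ℝ (Fin 3)) (p' : ℝ → UnitAddTorus (Fin 3) → ℝ), 0 < τ' ∧ IsClassicalNSSolutionOn Set.univ ν (fun _ => force S q.1) u' p' ∧ Function.Periodic u' τ' ∧ ∀ t, (∫ x, ‖u' t x - u (τ / τ' * t) x‖ ^ 2) + gradNormSq (fun x => u' t x - u (τ / τ' * t) x) ≤ δ) → (∀ η : ℝ, 0 < η → ∃ (c₁ : Coeff S) (s₁ s₂ : ℝ), dist c₁ c < η ∧ |s₁| < η ∧ |s₂| < η ∧ σ (c₁, s₁) < 0 ∧ 0 < σ (c₁, s₂)) → c ∈ closure (interior (loud S a E ε)) := by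
  -- adapted from Theorems/BaireTransferRobustLoudUpgradeStubRobustCrossingClosure.lean
  -- `stub_robustCrossingClosure` (steady twin), with the periodic window in place of the steady one
  intro S a E ε c ν τ u p σ hν hνa hτ hsol hper hE hε hzero hcross
  -- (1) the budget window of `u`
  obtain ⟨δ, hδ0, hwin⟩ := exists_window (a := a) hν hνa hτ hsol hper hE hε
  -- (2) on a ball around `(c, 0)`, `σ` is continuous and its zeros give `δ`-close periodic solutions
  obtain ⟨r, hr, hcont, hz⟩ := hzero δ hδ0
  -- (3) closure
  rw [Metric.mem_closure_iff]
  intro θ hθ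
  obtain ⟨c₁, s₁, s₂, hc₁, hs₁, hs₂, hσ₁, hσ₂⟩ :=
    hcross (min θ (r / 2)) (lt_min hθ (half_pos hr))
  have hc₁r : dist c₁ c < r / 2 := hc₁.trans_le (min_le_right _ _)
  have hs₁r : |s₁| < r / 2 := hs₁.trans_le (min_le_right _ _)
  have hs₂r : |s₂| < r / 2 := hs₂.trans_le (min_le_right _ _)
  -- `c' ↦ σ (c', s)` is continuous at `c₁` whenever `|s| < r / 2`
  have hat : ∀ s : ℝ, |s| < r / 2 → ContinuousAt (fun c' : Coeff S => σ (c', s)) c₁ := by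
    intro s hs
    have hmem : ((c₁, s) : Coeff S × ℝ) ∈ Metric.ball (c, (0 : ℝ)) r :=
      Metric.mem_ball.2 ((dist_mk_lt hc₁r hs).trans_le (half_le_self hr.le))
    have hca : ContinuousAt σ (c₁, s) := hcont.continuousAt (Metric.isOpen_ball.mem_nhds hmem)
    have hf : Continuous fun c' : Coeff S => ((c', s) : Coeff S × ℝ) := by fun_prop
    exact ContinuousAt.comp' (f := fun c' : Coeff S => ((c', s) : Coeff S × ℝ)) (x := c₁) hca
      hf.continuousAt
  -- the strict signs persist on a ball around `c₁`
  have h₁ : ∀ᶠ c' in 𝓝 c₁, σ (c', s₁) < 0 :=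
    Filter.Tendsto.eventually_lt_const hσ₁ (hat s₁ hs₁r)
  have h₂ : ∀ᶠ c' in 𝓝 c₁, 0 < σ (c', s₂) :=
    Filter.Tendsto.eventually_const_lt hσ₂ (hat s₂ hs₂r)
  obtain ⟨ρ', hρ', hρ'σ⟩ := Metric.eventually_nhds_iff.1 (h₁.and h₂)
  obtain ⟨ρ, hρ, hρρ', hρr⟩ : ∃ ρ : ℝ, 0 < ρ ∧ ρ ≤ ρ' ∧ ρ ≤ r / 2 :=
    ⟨min ρ' (r / 2), lt_min hρ' (half_pos hr), min_le_left _ _, min_le_right _ _⟩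
  -- the ball of radius `ρ` around `c₁` is loud
  have hsub : Metric.ball c₁ ρ ⊆ loud S a E ε := by
    intro c' hc'
    rw [Metric.mem_ball] at hc'
    have hc'r : dist c' c < r :=
      calc dist c' c ≤ dist c' c₁ + dist c₁ c := dist_triangle _ _ _
        _ < r / 2 + r / 2 := add_lt_add (hc'.trans_le hρr) hc₁r
        _ = r := add_halves r
    obtain ⟨hneg, hpos⟩ := hρ'σ (hc'.trans_le hρρ')
    -- the segment `{c'} × [[s₁, s₂]]` lies in the ball of radius `r`
    have hseg : Set.MapsTo (fun s : ℝ => ((c', s) : Coeff S × ℝ)) (Set.uIcc s₁ s₂)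
        (Metric.ball (c, (0 : ℝ)) r) := fun s hs =>
      Metric.mem_ball.2
        (dist_mk_lt hc'r ((abs_lt_of_mem_uIcc hs₁r hs₂r hs).trans_le (half_le_self hr.le)))
    have hf : Continuous fun s : ℝ => ((c', s) : Coeff S × ℝ) := by fun_prop
    have hcont' : ContinuousOn (fun s : ℝ => σ (c', s)) (Set.uIcc s₁ s₂) :=
      hcont.comp hf.continuousOn hseg
    -- intermediate value theorem: a zero of `σ (c', ·)` on the segment
    have hmem : (0 : ℝ) ∈ Set.uIcc (σ (c', s₁)) (σ (c', s₂)) :=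
      Set.mem_uIcc.2 (Or.inl ⟨hneg.le, hpos.le⟩)
    obtain ⟨s, hs, hσs⟩ := intermediate_value_uIcc hcont' hmem
    -- hence a `δ`-close periodic classical solution of `f_{c'}`, hence `c'` is loud
    obtain ⟨τ', u', p', hτ', hsol', hper', hcl⟩ := hz _ (hseg hs) hσs
    exact hwin c' τ' u' p' hτ' hsol' hper' hcl
  refine ⟨c₁, interior_maximal hsub Metric.isOpen_ball (Metric.mem_ball_self hρ), ?_⟩
  rw [dist_comm]
  exact hc₁.trans_le (min_le_left _ _)

end Summit.AnomalousDissipation.AnomalousDissipation.Theorems.RobustLoudUpgrade.PeriodicRobustCrossingClosure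

end
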